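import Summits.BirchSwinnertonDyer.Rank1Residual.Additive.LocIrrValuationCriterionThreeProofs
import Summits.BirchSwinnertonDyer.Rank1Residual.Additive.GordIsogenyInvarianceClasses
import Literature.NumberTheory.EllipticCurves.RootNumberTableThree
import HarnessLib

/-!
# The SELECTOR IDENTITY on the tame potentially supersingular cell at `3`, DERIVED: o5-r1's bit
# `v₃(j − 1728) ≥ 7` IS `LocIrr W 3` on (t′), from L-O56-sel (a theorem) and the `v(N)` column of
# Rizzo's Table II (a cited named fact) — `Additive.SelectorIdentityTameThree` modulo that one fact
# (cell `b2b-bsdres`; seat `b2b-bsdres-x11b3-p7` GEN 7 as CROSS-CELL POOL HAND on harvest-2's note E89 §4;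
#  theorems only)

HONEST FRAMING (cell `b2b-bsdres`, run/shared/lean/b2b/bsd-rank1-residual/, verbatim in every file): the
goal of the cell is to DELETE the COMBINATION-SHAPED residual classes of the Birch–Swinnerton-Dyer formula
for ALL analytic-rank `≤ 1` elliptic curves over `ℚ` — "full BSD formula for every rank `≤ 1` curve in
class `C`" assembled STRICTLY from published theorems — so that the rank-`≤ 1` remainder becomes exactly
the CONSTRUCTION-SHAPED classes, which are TYPED (missing-input `Prop`s), NOT attempted. This is not
"finishing BSD". Lane CLASS-CLOSURE / teams o5–o6 (O5 OPEN): research routes; census output is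
EVIDENCE, never a Literature fact; nothing is booked; no mark of `RESIDUAL-MAP.md` moves. This file:
THEOREMS ONLY (no definition, no named fact minted, no `@[conjecture]` node, no `sorry`; net named-fact
debt `0`). The ONE published input that is not a tree theorem — the `v(N)` column of Rizzo's Table II —
enters as the EXISTING named fact `WeierstrassCurve.conductorExponent_eq_tableConductorExponentThree`
taken as an EXPLICIT HYPOTHESIS `h3` (cited, NOT discharged, NOT restated): every theorem of §3 is
CONDITIONAL on it.

## What is proved

cc-typer-5 GEN 3's TARGET **`Additive.SelectorIdentityTameThree`**
(`Additive/LocIrrValuationCriterionThree.lean`; EVIDENCE 36 323 / 0, o6-r1 GEN 3 (G3-10), kit j124555;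
harvest-2 GEN 42 E89 §4: "NOT done … typer/prover item via
`conductorExponent_eq_tableConductorExponentThree`") in the form

* **`selectorIdentityTameThree_of_tableII (h3 : ∀ W, W.conductorExponent_eq_tableConductorExponentThree)
  : SelectorIdentityTameThree`** — for every elliptic, globally minimal `W/ℚ` with `ClassO5 W 3`,
  `SubTprime W 3`, `j ≠ 1728`: `LocIrr W 3 ↔ 7 ≤ v₃(j − 1728)`;

assembled from

* §1 `rizzo_tableII_condExp_eq_two` — pure bookkeeping on the transcription `Rizzo.tableII`: the
  conductor column reads `2` exactly on the six reduced triples `(≥2,3,3)` (III, special condition),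
  `(2,≥5,3)` (III), `(2,3,≥6)` (`I*_{c−6}`), `(3,≥6,6)` (`I₀*`), `(≥4,6,9)` (III*, special condition),
  `(4,≥8,9)` (III*);
* §2 `rows_of_condExpOfInvariants_eq_two` — on rational invariants with `c₆ ≠ 0`: `v(N) = 2` by the
  table, `ord₃ j ≥ 0` (`v₃Δ ≤ 3·v₃c₄` if `c₄ ≠ 0`) and `6 ∤ v₃(Δ)` leave the four III/III* rows, on which
  `2·v₃(c₆) − v₃(Δ) = 3` with the valuation criterion `c₄ ≠ 0 ∧ 3·v₃(c₄) + 2 ≤ 2·v₃(c₆)` FALSE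
  (`(≥2,3,3)`, `(≥4,6,9)`), or `2·v₃(c₆) − v₃(Δ) ≥ 7` with the criterion TRUE (`(2,≥5,3)`, `(4,≥8,9)`)
  — all four quantities are invariant under Rizzo's shift `(a,b,c) − m·(4,6,12)`, so no minimality
  enters; the WILD rows `(2,4,3)` (II) and `(4,7,9)` (IV*), on which the criterion holds but
  `v₃(j − 1728) = 5` (harvest-2's NB in E89 §4), are excluded by `v(N) = 2`;
* §3 `j_sub_eq_c₆_sq_div_Δ` (`j − 1728 = c₆²/Δ`), `padicValRat_j_sub_eq` (`v₃(j − 1728) = 2·v₃c₆ − v₃Δ`),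
  `padicValRat_j_eq` (`v₃ j = 3·v₃c₄ − v₃Δ`), `padicValRat_Δ_eq_padicValInt_minimalDiscriminantInt`;
  **`locIrr_three_iff_seven_le_of_subTprime_of_tableII`** (per curve: `h3` for THIS `W`, `SubTprime W 3`,
  `j ≠ 1728`; `ClassO5` not needed) via harvest-2's THEOREM `locIrrThreeIffCriterion_holds` (L-O56-sel,
  p292696); and the census gap **`padicValRat_j_sub_eq_three_or_seven_le_of_subTprime_of_tableII`**:
  `v₃(j − 1728) ∈ {3} ∪ [7, ∞)` on (t′) (o5-r1's "never `4, 5, 6`").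

Effect for consumers: the `hsel : SelectorIdentityTameThree` binder of
`Additive/MazurTateGrowthDichotomyThree.lean` (`growthDichotomy_locIrr_of_growthDichotomyLaw`,
`growthDichotomyLaw_conclusion_of_locIrr`, `growthDichotomyLawThree_of_ne_1728`) becomes the term
`selectorIdentityTameThree_of_tableII h3`, i.e. those bridges hold modulo the cited Table II column
alone. WORDING (EVIDENCE framing; the o5/o6 planners and cc-typer-5 rule on any `TYPED.md` /
`TARGETS.md` line): "SELECTOR IDENTITY on O5b DERIVED from L-O56-sel (theorem) + the cited Table II
conductor column (named fact, not discharged); census 36 323 / 0 stays EVIDENCE; nothing booked; no mark."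

## What is NOT here

No discharge of `conductorExponent_eq_tableConductorExponentThree` (Tate's algorithm at `3` versus the
printed table — that is the whole content of the table); no unconditional version (route for a sequel:
the tree's `subTprime_three_iff_kodairaSymbolAt_III_or_IIIstar` + the Step-4 / Step-9 normal forms of
Tate's algorithm give `v₃(c₆) ≠ 4` on III and `≠ 7` on III* directly); nothing at `j = 1728` (there
`LocIrr` holds by `locIrr_three_of_c₆_eq_zero'` and the selector `v₃(0)` is junk, as the TARGET says);
no census, no kit job; the `@[conjecture]` nodes of `O5/O5GrowthLaws.lean` /
`Additive/MazurTateGrowthDichotomyThree.lean` are untouched.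

References: O. Rizzo, *Average root numbers for a nonconstant family of elliptic curves*, Compositio
Math. 136 (2003) 1–23, Table II (p. 4) and §1.1–1.2 [Rizzo2003]; A. Kraus, Manuscripta Math. 69 (1990)
353–385 (types III, III* tame at `3`); O. Fouquet, X. Wan, arXiv:2107.13726 Thm 5.1 (the (Lgl) bit
`LocIrr`) [FouquetWan2021]; `cells/o5o6/TARGETS.md` §O5 (o5-r1 T9) and §O6 (o6-r1 GEN 3 (G3-10));
`HOME/b2b-bsdres-harvest-2/gen42/E89-LocIrr3-kernel.md` §4.
-/

noncomputable section

open scoped Classical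

open WeierstrassCurve Literature.NumberTheory.EllipticCurves
  Literature.NumberTheory.EllipticCurves.Rank1Residual
  Literature.NumberTheory.EllipticCurves.Rank1Residual.Typed

namespace Summit.BirchSwinnertonDyer.Rank1Residual.Additive

/-! ## §1 The rows of Table II with `v(N) = 2` (pure bookkeeping on the transcribed table) -/

section Table

/-- Projection `.2` commutes with `if`. [folklore] -/
private theorem snd_ite' {α β : Type*} (P : Prop) [Decidable P] (x y : α × β) :
    (if P then x else y).2 = if P then x.2 else y.2 := by
  split <;> rfl

/-- Projection `.1` commutes with `if`. [folklore] -/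
private theorem fst_ite' {α β : Type*} (P : Prop) [Decidable P] (x y : α × β) :
    (if P then x else y).1 = if P then x.1 else y.1 := by
  split <;> rfl

/-- One step of the `if`-cascade. [folklore] -/
private theorem ite_eq_peel {α : Type*} {P : Prop} [Decidable P] {x y n : α}
    (h : (if P then x else y) = n) : (P ∧ x = n) ∨ (¬ P ∧ y = n) := by
  by_cases hP : P
  · exact Or.inl ⟨hP, by rwa [if_pos hP] at h⟩
  · exact Or.inr ⟨hP, by rwa [if_neg hP] at h⟩

/-- One step of the `if`-cascade past a row whose value is not the target. [folklore] -/
private theorem ite_eq_peel_ne {α : Type*} {P : Prop} [Decidable P] {x y n : α} (hx : x ≠ n)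
    (h : (if P then x else y) = n) : y = n := by
  rcases ite_eq_peel h with ⟨-, h⟩ | ⟨-, h⟩
  · exact absurd h hx
  · exact h

/-- **The six rows of Rizzo's Table II whose conductor column reads `v(N) = 2`**: on the reduced
triple `(a, b, c)` they are `(≥2, 3, 3)` (III, special condition), `(2, ≥5, 3)` (III),
`(2, 3, ≥6)` (`I*_{c−6}`), `(3, ≥6, 6)` (`I₀*`), `(≥4, 6, 9)` (III*, special condition),
`(4, ≥8, 9)` (III*); every other row (and the junk value off the rows) has `v(N) ≠ 2`. Pure case
analysis of the transcription `Rizzo.tableII`; nothing about curves.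
[cite: Rizzo2003, Table II (p. 4), column v(N)] -/
theorem rizzo_tableII_condExp_eq_two {a b : WithTop ℤ} {c c4' c6' Δ' : ℤ}
    (h : (Rizzo.tableII a b c c4' c6' Δ').2.1 = 2) :
    (KellockDokchitser.atLeast a 2 = true ∧ b = 3 ∧ c = 3) ∨
    (a = 2 ∧ KellockDokchitser.atLeast b 5 = true ∧ c = 3) ∨
    (a = 2 ∧ b = 3 ∧ 6 ≤ c) ∨ (a = 3 ∧ KellockDokchitser.atLeast b 6 = true ∧ c = 6) ∨
    (KellockDokchitser.atLeast a 4 = true ∧ b = 6 ∧ c = 9) ∨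
    (a = 4 ∧ KellockDokchitser.atLeast b 8 = true ∧ c = 9) := by
  unfold Rizzo.tableII at h
  dsimp only at h
  simp only [snd_ite', fst_ite'] at h
  replace h := ite_eq_peel_ne (by decide) h
  replace h := ite_eq_peel_ne (by decide) h
  replace h := ite_eq_peel_ne (by decide) h
  replace h := ite_eq_peel_ne (by decide) h
  replace h := ite_eq_peel_ne (by decide) h
  replace h := ite_eq_peel_ne (by decide) h
  obtain ⟨hc, -⟩ | ⟨-, h⟩ := ite_eq_peel h
  · exact Or.inl ⟨hc.1, hc.2.1, hc.2.2.1⟩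
  replace h := ite_eq_peel_ne (by decide) h
  obtain ⟨hc, -⟩ | ⟨-, h⟩ := ite_eq_peel h
  · exact Or.inr (Or.inl hc)
  replace h := ite_eq_peel_ne (by decide) h
  replace h := ite_eq_peel_ne (by decide) h
  replace h := ite_eq_peel_ne (by decide) h
  obtain ⟨hc, -⟩ | ⟨-, h⟩ := ite_eq_peel h
  · exact Or.inr (Or.inr (Or.inl hc))
  replace h := ite_eq_peel_ne (by decide) h
  obtain ⟨hc, -⟩ | ⟨-, h⟩ := ite_eq_peel h
  · exact Or.inr (Or.inr (Or.inr (Or.inl hc)))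
  replace h := ite_eq_peel_ne (by decide) h
  obtain ⟨hc, -⟩ | ⟨-, h⟩ := ite_eq_peel h
  · exact Or.inr (Or.inr (Or.inr (Or.inr (Or.inl ⟨hc.1, hc.2.1, hc.2.2.1⟩))))
  replace h := ite_eq_peel_ne (by decide) h
  replace h := ite_eq_peel_ne (by decide) h
  replace h := ite_eq_peel_ne (by decide) h
  obtain ⟨hc, -⟩ | ⟨-, h⟩ := ite_eq_peel h
  · exact Or.inr (Or.inr (Or.inr (Or.inr (Or.inr hc))))
  replace h := ite_eq_peel_ne (by decide) h
  replace h := ite_eq_peel_ne (by decide) h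
  replace h := ite_eq_peel_ne (by decide) h
  exact absurd h (by decide)

end Table

/-! ## §2 Table II read on the invariants: the four III/III* rows in the selector's currency -/

section Invariants

/-- `atLeast ⊤ k` holds (the printed "`≥ k`" rows admit the valuation `∞` of `0`). [folklore] -/
private theorem atLeast_top (k : ℤ) : KellockDokchitser.atLeast ⊤ k = true := rfl

/-- `atLeast ↑x k` is `k ≤ x`. [folklore] -/
private theorem atLeast_coe (x k : ℤ) :
    KellockDokchitser.atLeast (x : WithTop ℤ) k = decide (k ≤ x) := rfl

/-- **The III/III* rows, read in the two quantities the selector identity compares.** For rational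
invariants with `c₆ ≠ 0`, if Table II gives `v(N) = 2` (`Rizzo.condExpOfInvariants c₄ c₆ Δ = 2`),
`ord₃ j ≥ 0` in the form `v₃(Δ) ≤ 3·v₃(c₄)` when `c₄ ≠ 0`, and `6 ∤ v₃(Δ)`, then the reduced triple
is one of `(≥2,3,3)`, `(≥4,6,9)` — where `2·v₃(c₆) − v₃(Δ) = 3` and the valuation criterion
`c₄ ≠ 0 ∧ 3·v₃(c₄) + 2 ≤ 2·v₃(c₆)` FAILS — or one of `(2,≥5,3)`, `(4,≥8,9)` — where
`2·v₃(c₆) − v₃(Δ) ≥ 7` and the criterion HOLDS; the rows `(2,3,≥6)` (`Iₙ*`) and `(3,≥6,6)` (`I₀*`)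
are excluded by `ord₃ j ≥ 0` / `6 ∤ v₃(Δ)`. All four quantities are invariant under the shift
`(a,b,c) ↦ (a,b,c) − m·(4,6,12)` of §1.1, so no minimality is needed here.
[cite: Rizzo2003, Table II (p. 4) and §1.1–1.2 (pp. 3–4)] -/
theorem rows_of_condExpOfInvariants_eq_two {c₄ c₆ Δ : ℚ} (hc6 : c₆ ≠ 0)
    (h : Rizzo.condExpOfInvariants c₄ c₆ Δ = 2)
    (hpot : c₄ ≠ 0 → padicValRat 3 Δ ≤ 3 * padicValRat 3 c₄)
    (h6 : ¬ (6 : ℤ) ∣ padicValRat 3 Δ) :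
    (2 * padicValRat 3 c₆ - padicValRat 3 Δ = 3 ∧
        ¬ (c₄ ≠ 0 ∧ 3 * padicValRat 3 c₄ + 2 ≤ 2 * padicValRat 3 c₆)) ∨
      (7 ≤ 2 * padicValRat 3 c₆ - padicValRat 3 Δ ∧
        (c₄ ≠ 0 ∧ 3 * padicValRat 3 c₄ + 2 ≤ 2 * padicValRat 3 c₆)) := by
  unfold Rizzo.condExpOfInvariants Rizzo.ofInvariants at h
  dsimp only at h
  set m := KellockDokchitser.shift (padicValRat 3 Δ) (Rizzo.val3 c₆) (Rizzo.val3 c₄) with hm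
  clear_value m
  have hv6 : Rizzo.val3 c₆ = ((padicValRat 3 c₆ : ℤ) : WithTop ℤ) := by simp [Rizzo.val3, hc6]
  rw [hv6, WithTop.map_coe] at h
  by_cases hc4 : c₄ = 0
  · have hv4 : Rizzo.val3 c₄ = ⊤ := by simp [Rizzo.val3, hc4]
    rw [hv4, WithTop.map_top] at h
    rcases rizzo_tableII_condExp_eq_two h with
      ⟨-, hb, hc⟩ | ⟨ha, -, -⟩ | ⟨ha, -, -⟩ | ⟨ha, -, -⟩ | ⟨-, hb, hc⟩ | ⟨ha, -, -⟩
    · simp only [WithTop.coe_eq_ofNat] at hb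
      exact Or.inl ⟨by omega, fun h' => h'.1 hc4⟩
    · exact absurd ha (WithTop.top_ne_ofNat 2)
    · exact absurd ha (WithTop.top_ne_ofNat 2)
    · exact absurd ha (WithTop.top_ne_ofNat 3)
    · simp only [WithTop.coe_eq_ofNat] at hb
      exact Or.inl ⟨by omega, fun h' => h'.1 hc4⟩
    · exact absurd ha (WithTop.top_ne_ofNat 4)
  · have hv4 : Rizzo.val3 c₄ = ((padicValRat 3 c₄ : ℤ) : WithTop ℤ) := by simp [Rizzo.val3, hc4]
    rw [hv4, WithTop.map_coe] at h
    have hpot' := hpot hc4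
    rcases rizzo_tableII_condExp_eq_two h with
      ⟨ha, hb, hc⟩ | ⟨ha, hb, hc⟩ | ⟨ha, hb, hc⟩ | ⟨ha, hb, hc⟩ | ⟨ha, hb, hc⟩ | ⟨ha, hb, hc⟩
    all_goals
      simp only [WithTop.coe_eq_ofNat, atLeast_coe, decide_eq_true_eq] at ha hb
    · exact Or.inl ⟨by omega, fun h' => by omega⟩
    · exact Or.inr ⟨by omega, hc4, by omega⟩
    · exact absurd (show (6 : ℤ) ∣ padicValRat 3 Δ from ⟨m + 1, by omega⟩) h6
    · exact absurd (show (6 : ℤ) ∣ padicValRat 3 Δ from ⟨2 * m + 1, by omega⟩) h6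
    · exact Or.inl ⟨by omega, fun h' => by omega⟩
    · exact Or.inr ⟨by omega, hc4, by omega⟩

end Invariants

/-! ## §3 The selector identity on O5b, modulo the Table II conductor fact -/

section Curves

/-- `6 ∣ v ⟹ e = 12 / gcd(12, v) ∣ 2` (`gcd ∈ {6, 12}`): the census index `e` divides `p − 1 = 2`
exactly on the `I₀*`-type valuations. [folklore] -/
private theorem twelve_div_gcd_dvd_two_of_six_dvd {v : ℕ} (h : 6 ∣ v) : 12 / Nat.gcd 12 v ∣ 2 := by
  obtain ⟨k, rfl⟩ := h
  have hg : Nat.gcd 12 (6 * k) = 6 * Nat.gcd 2 k := by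
    rw [show (12 : ℕ) = 6 * 2 from rfl, Nat.gcd_mul_left]
  rcases (Nat.dvd_prime Nat.prime_two).1 (Nat.gcd_dvd_left 2 k) with h1 | h2
  · rw [hg, h1]
  · rw [hg, h2]; norm_num

variable (W : WeierstrassCurve ℚ) [W.IsElliptic]

/-- `j − 1728 = c₆² / Δ` (`1728 Δ = c₄³ − c₆²`). [folklore] -/
theorem j_sub_eq_c₆_sq_div_Δ : W.j - 1728 = W.c₆ ^ 2 / W.Δ := by
  have hΔ : W.Δ ≠ 0 := by rw [← W.coe_Δ']; exact W.Δ'.ne_zero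
  rw [WeierstrassCurve.j, Units.val_inv_eq_inv_val, W.coe_Δ', eq_div_iff hΔ]
  have := W.c_relation
  field_simp
  linear_combination -this

/-- `j = 1728 ⟺ c₆ = 0` for an elliptic curve in characteristic `0`. [folklore] -/
theorem c₆_ne_zero_of_j_ne (hj : W.j ≠ 1728) : W.c₆ ≠ 0 := by
  intro h
  apply hj
  have hΔ : W.Δ ≠ 0 := by rw [← W.coe_Δ']; exact W.Δ'.ne_zero
  have := j_sub_eq_c₆_sq_div_Δ W
  rw [h, zero_pow two_ne_zero, zero_div, sub_eq_zero] at this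
  exact this

/-- `v₃(j − 1728) = 2·v₃(c₆) − v₃(Δ)` when `c₆ ≠ 0`. [folklore] -/
theorem padicValRat_j_sub_eq (hc6 : W.c₆ ≠ 0) :
    padicValRat 3 (W.j - 1728) = 2 * padicValRat 3 W.c₆ - padicValRat 3 W.Δ := by
  have hΔ : W.Δ ≠ 0 := by rw [← W.coe_Δ']; exact W.Δ'.ne_zero
  rw [j_sub_eq_c₆_sq_div_Δ, padicValRat.div (pow_ne_zero 2 hc6) hΔ, padicValRat.pow]
  push_cast
  ring

/-- `v₃(j) = 3·v₃(c₄) − v₃(Δ)` when `c₄ ≠ 0`. [folklore] -/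
theorem padicValRat_j_eq (hc4 : W.c₄ ≠ 0) :
    padicValRat 3 W.j = 3 * padicValRat 3 W.c₄ - padicValRat 3 W.Δ := by
  have hΔ : W.Δ ≠ 0 := by rw [← W.coe_Δ']; exact W.Δ'.ne_zero
  rw [WeierstrassCurve.j, Units.val_inv_eq_inv_val, W.coe_Δ', inv_mul_eq_div,
    padicValRat.div (pow_ne_zero 3 hc4) hΔ, padicValRat.pow]
  push_cast
  ring

variable [W.IsGloballyMinimal]

omit [W.IsElliptic] in
/-- `v₃(Δ) = v₃(Δ_min)` on a globally minimal equation. [folklore] -/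
theorem padicValRat_Δ_eq_padicValInt_minimalDiscriminantInt :
    padicValRat 3 W.Δ = padicValInt 3 W.minimalDiscriminantInt := by
  rw [← cast_minimalDiscriminantInt W, padicValRat.of_int]

/-- **The selector identity on (t′) at `3`, modulo the Table II conductor fact.** For `W/ℚ` elliptic
and globally minimal in the census cell (t′) at `3` (`SubTprime W 3`: `ord₃ j ≥ 0`, `f₃ = 2`,
`e ∤ 2`) with `j ≠ 1728`, GIVEN the named fact `h3` that the tree's conductor exponent at `3` is the
`v(N)` column of Rizzo's Table II (cited, not discharged): `E[3]|G_{ℚ₃}` is irreducible iff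
`7 ≤ v₃(j − 1728)`. Route: `f₃ = 2` + `ord₃ j ≥ 0` + `6 ∤ v₃(Δ_min)` put the reduced triple in one of
the four III/III* rows (§2); there `2·v₃(c₆) − v₃(Δ) ∈ {3} ∪ [7, ∞)` is `≥ 7` exactly when the
valuation criterion holds, and the criterion is `LocIrr W 3` by L-O56-sel
(`locIrrThreeIffCriterion_holds`). `ClassO5 W 3` is not needed.
[cite: Rizzo2003, Table II (p. 4), column v(N)] -/
theorem locIrr_three_iff_seven_le_of_subTprime_of_tableII
    (h3 : W.conductorExponent_eq_tableConductorExponentThree)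
    (hT : SubTprime W 3) (hj : W.j ≠ 1728) :
    LocIrr W 3 ↔ 7 ≤ padicValRat 3 (W.j - 1728) := by
  obtain ⟨hpm, hf, he⟩ := hT
  have hc6 : W.c₆ ≠ 0 := c₆_ne_zero_of_j_ne W hj
  -- `f₃ = 2` read on Table II
  have htab : Rizzo.condExpOfInvariants W.c₄ W.c₆ W.Δ = 2 := by
    have h := h3 (placeOf 3) (ringChar_int_quot_placeOf 3)
    rw [tableConductorExponentThree_def] at h
    rw [← h]
    exact hf
  -- `ord₃ j ≥ 0`
  have hpot : W.c₄ ≠ 0 → padicValRat 3 W.Δ ≤ 3 * padicValRat 3 W.c₄ := by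
    intro hc4
    have h0 : ¬ padicValRat 3 W.j < 0 := hpm
    rw [padicValRat_j_eq W hc4] at h0
    omega
  -- `e ∤ 2 ⟹ 6 ∤ v₃(Δ)`
  have h6 : ¬ (6 : ℤ) ∣ padicValRat 3 W.Δ := by
    intro h6
    apply he
    rw [show 3 - 1 = 2 from rfl]
    apply twelve_div_gcd_dvd_two_of_six_dvd
    rw [padicValRat_Δ_eq_padicValInt_minimalDiscriminantInt] at h6
    exact_mod_cast h6
  rw [locIrrThreeIffCriterion_holds W, padicValRat_j_sub_eq W hc6]
  unfold LocIrrCriterionThree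
  rcases rows_of_condExpOfInvariants_eq_two hc6 htab hpot h6 with ⟨h3', hcrit⟩ | ⟨h7, hcrit⟩
  · rw [h3']
    constructor
    · rintro ⟨hc4, h0 | hle⟩
      · exact absurd h0 hc6
      · exact absurd ⟨hc4, hle⟩ hcrit
    · intro h; omega
  · exact ⟨fun _ => h7, fun _ => ⟨hcrit.1, Or.inr hcrit.2⟩⟩

/-- **The census gap `v₃(j − 1728) ∈ {3} ∪ [7, ∞)` on (t′) at `3`** (o5-r1's observation "never
`4, 5, 6`"; EVIDENCE 36 323 rows), modulo the Table II conductor fact: the III/III* rows have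
`2·v₃(c₆) − v₃(Δ) = 3` (`(≥2,3,3)`, `(≥4,6,9)`) or `≥ 7` (`(2,≥5,3)`, `(4,≥8,9)`).
[cite: Rizzo2003, Table II (p. 4), rows III and III*] -/
theorem padicValRat_j_sub_eq_three_or_seven_le_of_subTprime_of_tableII
    (h3 : W.conductorExponent_eq_tableConductorExponentThree)
    (hT : SubTprime W 3) (hj : W.j ≠ 1728) :
    padicValRat 3 (W.j - 1728) = 3 ∨ 7 ≤ padicValRat 3 (W.j - 1728) := by
  obtain ⟨hpm, hf, he⟩ := hT
  have hc6 : W.c₆ ≠ 0 := c₆_ne_zero_of_j_ne W hj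
  have htab : Rizzo.condExpOfInvariants W.c₄ W.c₆ W.Δ = 2 := by
    have h := h3 (placeOf 3) (ringChar_int_quot_placeOf 3)
    rw [tableConductorExponentThree_def] at h
    rw [← h]
    exact hf
  have hpot : W.c₄ ≠ 0 → padicValRat 3 W.Δ ≤ 3 * padicValRat 3 W.c₄ := by
    intro hc4
    have h0 : ¬ padicValRat 3 W.j < 0 := hpm
    rw [padicValRat_j_eq W hc4] at h0
    omega
  have h6 : ¬ (6 : ℤ) ∣ padicValRat 3 W.Δ := by
    intro h6
    apply he
    rw [show 3 - 1 = 2 from rfl]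
    apply twelve_div_gcd_dvd_two_of_six_dvd
    rw [padicValRat_Δ_eq_padicValInt_minimalDiscriminantInt] at h6
    exact_mod_cast h6
  rw [padicValRat_j_sub_eq W hc6]
  rcases rows_of_condExpOfInvariants_eq_two hc6 htab hpot h6 with ⟨h3', -⟩ | ⟨h7, -⟩
  · exact Or.inl h3'
  · exact Or.inr h7

/-- **`SelectorIdentityTameThree` DERIVED, modulo the Table II conductor fact** (cc-typer-5's
TARGET in `Additive/LocIrrValuationCriterionThree.lean`, binders verbatim): GIVEN the named fact that
for every `W/ℚ` the tree's conductor exponent at `3` is Table II's `v(N)` (cited, not discharged),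
every elliptic, globally minimal `W` with `ClassO5 W 3`, `SubTprime W 3`, `j ≠ 1728` satisfies
`LocIrr W 3 ↔ 7 ≤ v₃(j − 1728)`. EVIDENCE 36 323 / 0 (kit j124555) stays EVIDENCE; this makes the
`hsel` binder of `Additive/MazurTateGrowthDichotomyThree.lean` the term
`selectorIdentityTameThree_of_tableII h3`; nothing booked. [cite: Rizzo2003, Table II (p. 4), column v(N)] -/
theorem selectorIdentityTameThree_of_tableII
    (h3 : ∀ W : WeierstrassCurve ℚ, W.conductorExponent_eq_tableConductorExponentThree) :
    SelectorIdentityTameThree :=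
  fun W _ _ _ hT hj => locIrr_three_iff_seven_le_of_subTprime_of_tableII W (h3 W) hT hj

end Curves

end Summit.BirchSwinnertonDyer.Rank1Residual.Additive

end
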